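import Literature.MathematicalPhysics.QuantumFieldTheory.Balaban1983to89.B2Ineq335RegularFieldConcrete

/-!
# `Balaban1983to89.B2Ineq339RegularFieldConcrete` — [Balaban1982Higgs2] §3.B p. 591: **(3.22) ⇒ (3.39) AT A REGULAR NON-ZERO
VECTOR FIELD `Ã^ε` ON THE CONCRETE (Higgs)₂,₃ CARRIER, NO (3.26)/(3.35) HYPOTHESIS LEFT** (file 2/2 of the gen-7 target; file 1/2
`B2Ineq335RegularFieldConcrete` = (3.35) at `Ã^ε` with the restricted Proposition 3.1 discharged) — gen 4's knit
`B2Ineq339Gathering.ineq339_knit` ((3.36) = (3.37) ≤ (3.38) ⇒ (3.39) on the concrete carrier, valid at every `Ã^ε`: the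
substitution `Φ = √2Φ′`, the normalization (3.32), the diamagnetic inequality of [I.5]) with its input `h335` SUPPLIED by file 1's
`ineq335_regular`, in two shapes: the explicit error factor `e^{¼Σ_{k=1}^{K}E_k}`, `E_k = 64γ₀d³e²(Lᵏδ_k)²Ψ_k²(Lᵏε)^d|Λ_k|`, and the
printed absorption `exp(O(1)Σ_{k=0}^{K}|Λ_k|)` under a uniform bound on the error density — the companion of gen 6's zero-field
`B2Ineq335ZeroFieldConcrete.ineq339_zeroField`

statement-level skeleton of published theorems with citation tags; proofs where landed; nothing here is a claim about the Yang–Mills mass gap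

CITATION HEADER.  T. Bałaban, *(Higgs)₂,₃ quantum fields in a finite volume. II. An upper bound*, Commun. Math. Phys.
**86** (1982) 555–594 [Balaban1982Higgs2] (cell paper B2; PDF held `paper:balaban1982-cmp86-higgs23-ii`, journal page =
PDF page + 554; p. 591 [PDF 37] re-read this gen on the text layer `p0037.txt`, in gens 4/6 AS IMAGE on the ×2 render
`run/shared/lean/pub/pub-balaban/b2b-balaban-ref1/pages/1982-cmp86-higgs23-II/1982-cmp86-higgs23-II-p037-x2.png`).  Unit
`lit-balaban-p15` gen 7 (Phase-2 proof seat p15; HOME `run/shared/lean/pub/lit-balaban/`).  SKELETON row **B2.Eq3.32** (members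
(3.35)–(3.39); fold owner r02, second reader r14, referee ref-4), companion row B2.Prop3.1.  USED BY NAME (nothing restated): file 1's
`ineq335_regular`, `errTerm`, `sum_errTerm`, `bondTermA`; gen 6's `B2Ineq335ZeroFieldConcrete.{KSite, Sites, cfgOf, Bnd, bondSet,
lintegral_weight4_eq}`, `B2Ineq335Exceptions.rhs322`, `B2Ineq335Printed.{excLevel, largeFieldSite}`, r14's
`B2Eq337LastIntegrations.gaussLevel`; gen 4's `B2Ineq339Gathering.{vol, vol_nonneg, sum_vol, ineq339_knit}`,
`B2Eq325ConcreteSchur.{form325, Z325, Z325_pos}`, `B2Eq337ScalarIntegration.Cfg`, p28's `B2Ineq338Diamagnetic.E0s`.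

THE SOURCE TEXT (verbatim, p. 591).  (3.35): *"(the right side of (3.22)) ≦ ∫dΦ Z(Ã^ε)·exp(−¼⟨Φ, Δ(Ã^ε)Φ⟩) Π_{k=0}^{K−1} ζ′_{Λ₀⁽ᵏ⁾}
· exp Σ_{k=1}^{K} O((Lᵏε)^{κ₀})|Λ_k|."*  *"The functions ζ′_{Λ₀⁽ᵏ⁾} depend on the vector fields only. In the integral over Φ we make
the transformation Φ = √2Φ′ and we get ∫dΦ′Z(Ã^ε)exp(−½⟨Φ′,Δ(Ã^ε)Φ′⟩) exp(½ log 2 Σ_{k=0}^{K}|Λ_k|). (3.36) We apply the formula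
(3.23) to the underintegral expression. Next we use (3.32) again and it follows that the integral (3.36) is equal to
∫dφ₀exp(−½⟨φ₀, (−Δ^ε_{Ã^ε} + m²)φ₀⟩). (3.37) We apply the "diamagnetic inequality" of paper [I.5] to this integral, and we estimate
it by … (3.38) Gathering together the equalities and the estimates, we get (the expression {…} on the left side of (3.22)) ≦
Π_{k=0}^{K−1} ζ′_{Λ₀⁽ᵏ⁾} exp(E_{0,s}) exp(O(1) Σ_{k=0}^{K}|Λ_k|). (3.39)"*

WHAT IS PROVED (kernel-checked, 0 `sorry`, theorems only, standard axioms).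
 **`ineq339_regular_explicit`**: `((3.22)).toReal ≤ Π_{j<K}ζ′_j · e^{E_{0,s}} · e^{½N log 2·Σ_{k=0}^{K}|Λ_k|} · e^{¼Σ_{k=1}^{K}E_k}`
 (the knit applied to `(3.22)·e^{−¼ΣE}`, `c ≡ 0`); `sum_errTerm_div_four_le` (`¼ΣE_k ≤ C₀Σ_{k=0}^{K}|Λ_k|` once
 `16γ₀d³e²(Lᵏδ_k)²Ψ_k²(Lᵏε)^d ≤ C₀`); **`ineq339_regular`**: the printed shape `((3.22)).toReal ≤ Π_{j<K}ζ′_j · e^{E_{0,s}} ·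
 e^{(½N log 2 + C₀)Σ_{k=0}^{K}|Λ_k|}` — (3.39) with its `O(1) = ½N log 2 + C₀`.
HONEST SCOPE.  As in file 1: the regularity moduli `δ_k`, sup-bounds `Ψ_k`, smallness, and (here) the uniform bound `C₀` on the
error density (= the identification `64γ₀d³e²(Lᵏδ_k)²Ψ_k²(Lᵏε)^d = O((Lᵏε)^{κ₀}) ≤ O(1)`, pub-balaban GAPS G-pv07-1 (ii)) are
HYPOTHESES in p23's explicit reading of the (3.21) restrictions; the output structure of (3.22) is schematic (gen 6); `lhs` is
`(rhs322 …).toReal`, finite by the bound.  Value = the published §3.B scalar chain (3.22) ⇒ (3.39) closed at a regular external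
field on the concrete carrier; NOT summit progress.
-/

noncomputable section

open MeasureTheory Finset Function Real
open scoped ENNReal BigOperators

namespace Literature.MathematicalPhysics.QuantumFieldTheory.Balaban1983to89.B2Ineq339RegularFieldConcrete

open Literature.MathematicalPhysics.QuantumFieldTheory.Balaban1983to89.B2Ineq338Diamagnetic
open Literature.MathematicalPhysics.QuantumFieldTheory.Balaban1983to89.B2Eq337ScalarIntegration
open Literature.MathematicalPhysics.QuantumFieldTheory.Balaban1983to89.B2Eq325ConcreteSchur
open Literature.MathematicalPhysics.QuantumFieldTheory.Balaban1983to89.B2Eq328ConcretePieces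
open Literature.MathematicalPhysics.QuantumFieldTheory.Balaban1983to89.B2Ineq339Gathering
open Literature.MathematicalPhysics.QuantumFieldTheory.Balaban1983to89.B2Eq337LastIntegrations
open Literature.MathematicalPhysics.QuantumFieldTheory.Balaban1983to89.B2Ineq335Exceptions
open Literature.MathematicalPhysics.QuantumFieldTheory.Balaban1983to89.B2Ineq335Printed
open Literature.MathematicalPhysics.QuantumFieldTheory.Balaban1983to89.B2Ineq335ZeroFieldConcrete
open Literature.MathematicalPhysics.QuantumFieldTheory.Balaban1983to89.B2Ineq335RegularFieldConcrete

variable {P : HiggsLattice.Params} {N K : ℕ}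

/-! ## The knit at `Ã^ε`: (3.35) ⇒ (3.36) ⇒ (3.37) ⇒ (3.38) ⇒ (3.39) with NO (3.35)/(3.26) hypothesis left -/

section Knit

variable (R : Regions P K) (C : HiggsLattice.ChargeData N) (A : HiggsLattice.VecField P 0) {a msq : ℝ}
variable {O : ℕ → Type} [∀ i, Fintype (O i)] [∀ i, DecidableEq (O i)]
variable {ι : Fin K → Type*} [∀ j, Fintype (ι j)]

/-- **(3.22) ⇒ (3.39) AT A REGULAR `Ã^ε ≠ 0` ON THE CONCRETE CARRIER, explicit error**: gen 4's knit
`B2Ineq339Gathering.ineq339_knit` (= r14's `ineq339_of_335_338` with (3.36), (3.37), (3.38) discharged on the concrete carrier, any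
`Ã^ε`) applied to `(3.22)·e^{−¼ΣE_k}` with `h335` SUPPLIED by `ineq335_regular`:
`(3.22) ≤ Π_{j<K}ζ′_j · e^{E_{0,s}} · e^{½N log 2·(|Λ₅⁽⁰⁾ᶜ| + Σ_k|Λ_k|)} · e^{¼Σ_{k=1}^{K}E_k}` with `ζ′_j = Σ_τ w_{j,τ}
e^{−¼γ₀r_j|Q_s⁽ʲ⁾(τ)|}(e^{−⅛ar_j})^{|P_s⁽ʲ⁾(τ)|}` (real weights `w ≥ 0`), `E_k = 64γ₀d³e²(Lᵏδ_k)²Ψ_k²(Lᵏε)^d|Λ_k|`.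
[cite: Balaban1982Higgs2, (3.35)–(3.39) p.591] -/
theorem ineq339_regular_explicit (hR : Nested R) (hK : K ≤ P.K) (hε : P.mesh K ≤ 1) (ha : 0 < a) (hL : 1 < P.L)
    (hmsq : 0 < msq) {δ : Fin K → ℝ} (hδ : ∀ j, 0 ≤ δ j)
    (hreg : ∀ (j : Fin K), ∀ z ∈ pieceF R j, ∀ μ' ν : Fin P.d, |A ⟨z.shift ν, μ'⟩ - A ⟨z, μ'⟩| ≤ δ j)
    (hsmall : ∀ j : Fin K, 8 * (P.d : ℝ) ^ 4 * (P.L : ℝ) ^ P.d * C.e ^ 2 * P.mesh (j.val + 1) ^ 2 *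
      ((P.L : ℝ) ^ (j.val + 1)) ^ 2 * δ j ^ 2 ≤ 1 / 2)
    {γ₀ : ℝ} (hγ0 : 0 ≤ γ₀) (hγB : γ₀ * (8 * P.d + 2 * msq + 4) ≤ a * (1 - ((P.L : ℝ) ^ 2)⁻¹))
    (hγ16 : γ₀ ≤ 1 / 16) (Ψ : Fin K → ℝ) {s : ℕ → ℝ} (hs : ∀ j, 0 < s j)
    {c : (j : ℕ) → ((i : ℕ) → Sites R O i → V N) → Sites R O (j + 1) → V N} (hc : ∀ j, Measurable (c j))
    (hcdep : ∀ j i, j + 1 ≤ i → ∀ (x : (i : ℕ) → Sites R O i → V N) (y : Sites R O i → V N),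
      c j (update x i y) = c j x)
    {r : ℕ → ℝ} (hr : ∀ j, 4 * (N : ℝ) * Real.log 2 ≤ a * r j)
    {b : ((i : ℕ) → Sites R O i → V N) → ℝ} (hb : ∀ x, 0 ≤ b x ∧ b x ≤ 1)
    (hrestr : ∀ x, b x ≠ 0 → ∀ (j : Fin K) (y : LSite R j), ‖resL R j (cfgOf R (x 0)) y‖ ≤ Ψ j)
    (w : (j : Fin K) → ι j → ℝ) (hw : ∀ j τ, 0 ≤ w j τ)
    (Q : (j : Fin K) → ι j → Finset (Bnd P)) (hQ : ∀ j τ, Q j τ ⊆ bondSet R j)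
    (Pex : (j : Fin K) → ι j → Finset (Sites R O (j + 1)))
    (χQ : (j : Fin K) → ι j → (KSite R → V N) → ℝ) (hχ : ∀ j τ u, χQ j τ u = 0 ∨ χQ j τ u = 1)
    (hlarge : ∀ j τ u, χQ j τ u = 1 → ∀ bb ∈ Q j τ, r j < bondTermA R C A u bb)
    (x : (i : ℕ) → Sites R O i → V N) :
    (rhs322 (fun i => (volume : Measure (Sites R O i → V N)))
        (fun u => ENNReal.ofReal (Z325 R C a A msq * Real.exp (-(form325 R C a A msq (cfgOf R u) / 2))))
        (fun x => ENNReal.ofReal (b x))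
        (gaussLevel (fun j _ => a * s j) c) (fun j τ => ENNReal.ofReal (w j τ))
        (fun j τ u => ENNReal.ofReal (χQ j τ u))
        (fun j τ => excLevel c j (largeFieldSite (Pex j τ) (s j) (r j))) x).toReal
      ≤ (∏ j : Fin K, ∑ τ : ι j, w j τ * Real.exp (-(γ₀ * r j * (Q j τ).card / 4))
            * Real.exp (-(a * r j / 8)) ^ (Pex j τ).card)
        * Real.exp (E0s P C msq)
        * Real.exp (((N : ℝ) * Real.log 2 / 2 + 0) * ∑ k ∈ Finset.range (K + 1), vol R k)
        * Real.exp ((∑ n ∈ range (K + 1), errTerm R C γ₀ δ Ψ n) / 4) := by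
  have key := ineq335_regular R C A hR hK hε ha hL hmsq hδ hreg hsmall hγ0 hγB hγ16 Ψ hs hc hcdep hr hb hrestr
    (fun j τ => ENNReal.ofReal (w j τ)) Q hQ Pex χQ hχ hlarge x
  -- the real numbers of (3.35): the error factor, I₄ and Z′ = Πζ′
  set eE : ℝ := Real.exp ((∑ n ∈ range (K + 1), errTerm R C γ₀ δ Ψ n) / 4) with heE
  set I₄ : ℝ := ∫ Φ : Cfg R N, Z325 R C a A msq * Real.exp (-(form325 R C a A msq Φ / 4)) with hI₄
  set Zp : ℝ := ∏ j : Fin K, ∑ τ : ι j, w j τ * Real.exp (-(γ₀ * r j * (Q j τ).card / 4))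
    * Real.exp (-(a * r j / 8)) ^ (Pex j τ).card with hZp
  have hterm0 : ∀ j τ, 0 ≤ w j τ * Real.exp (-(γ₀ * r j * (Q j τ).card / 4))
      * Real.exp (-(a * r j / 8)) ^ (Pex j τ).card := fun j τ => by
    have := hw j τ; positivity
  have hZp0 : 0 ≤ Zp := Finset.prod_nonneg fun j _ => Finset.sum_nonneg fun τ _ => hterm0 j τ
  have hI0 : 0 ≤ I₄ :=
    integral_nonneg fun Φ => mul_nonneg (Z325_pos R C _ ha hL hmsq).le (Real.exp_pos _).le
  have heE0 : 0 < eE := Real.exp_pos _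
  -- the `[0,∞]` right side of `key` is `ofReal (eE * I₄ * Zp)`
  have hZ : (∏ j : Fin K, ∑ τ : ι j, ENNReal.ofReal (w j τ)
        * ENNReal.ofReal (Real.exp (-(γ₀ * r j * (Q j τ).card / 4)))
        * ENNReal.ofReal (Real.exp (-(a * r j / 8)) ^ (Pex j τ).card)) = ENNReal.ofReal Zp := by
    rw [hZp, ENNReal.ofReal_prod_of_nonneg fun j _ => Finset.sum_nonneg fun τ _ => hterm0 j τ]
    refine Finset.prod_congr rfl fun j _ => ?_
    rw [ENNReal.ofReal_sum_of_nonneg fun τ _ => hterm0 j τ]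
    refine Finset.sum_congr rfl fun τ _ => ?_
    rw [ENNReal.ofReal_mul (mul_nonneg (hw j τ) (Real.exp_pos _).le), ENNReal.ofReal_mul (hw j τ)]
  rw [lintegral_weight4_eq R C A ha hL hmsq, hZ, ← hI₄, ← ENNReal.ofReal_mul heE0.le,
    ← ENNReal.ofReal_mul (mul_nonneg heE0.le hI0)] at key
  have h4 := ENNReal.toReal_mono ENNReal.ofReal_ne_top key
  rw [ENNReal.toReal_ofReal (mul_nonneg (mul_nonneg heE0.le hI0) hZp0)] at h4
  -- move the error factor to the left: lhs / eE ≤ I₄ · Zp, then the gen-4 knit with c ≡ 0, then multiply back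
  set lhs : ℝ := (rhs322 (fun i => (volume : Measure (Sites R O i → V N)))
        (fun u => ENNReal.ofReal (Z325 R C a A msq * Real.exp (-(form325 R C a A msq (cfgOf R u) / 2))))
        (fun x => ENNReal.ofReal (b x))
        (gaussLevel (fun j _ => a * s j) c) (fun j τ => ENNReal.ofReal (w j τ))
        (fun j τ u => ENNReal.ofReal (χQ j τ u))
        (fun j τ => excLevel c j (largeFieldSite (Pex j τ) (s j) (r j))) x).toReal with hlhs
  have hdiv : lhs / eE ≤ I₄ * Zp := by
    rw [div_le_iff₀ heE0]
    calc lhs ≤ eE * I₄ * Zp := h4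
      _ = I₄ * Zp * eE := by ring
  have h335 : lhs / eE ≤ I₄ * Zp * Real.exp (∑ k ∈ Finset.Icc 1 K, (fun _ : ℕ => (0 : ℝ)) k * vol R k) := by
    simpa using hdiv
  have knit := ineq339_knit R C A ha hL hmsq hZp0 (C₀ := 0) (c := fun _ : ℕ => (0 : ℝ)) (fun k => by simp) h335
  rw [div_le_iff₀ heE0] at knit
  exact knit

/-- `Σ_{k=1}^{K}¼E_k ≤ C₀·Σ_{k=0}^{K}|Λ_k|` once the error DENSITY is uniformly bounded: `16γ₀d³e²(Lᵏδ_k)²Ψ_k²(Lᵏε)^d ≤ C₀`.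
[cite: Balaban1982Higgs2, (3.39) p.591] -/
theorem sum_errTerm_div_four_le {γ₀ : ℝ} (δ Ψ : Fin K → ℝ) {C₀ : ℝ} (hC₀ : 0 ≤ C₀)
    (hdens : ∀ j : Fin K, 16 * γ₀ * (P.d : ℝ) ^ 3 * C.e ^ 2 * ((P.L : ℝ) ^ (j.val + 1)) ^ 2 * δ j ^ 2 *
      (Ψ j ^ 2 * P.mesh (j.val + 1) ^ P.d) ≤ C₀) :
    (∑ n ∈ range (K + 1), errTerm R C γ₀ δ Ψ n) / 4 ≤ C₀ * ∑ k ∈ Finset.range (K + 1), vol R k := by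
  rw [sum_errTerm, sum_vol, Finset.sum_div, mul_add, Finset.mul_sum]
  have hout : 0 ≤ C₀ * (Fintype.card R.OutSite : ℝ) := mul_nonneg hC₀ (Nat.cast_nonneg _)
  have hsum : ∑ j : Fin K, 64 * γ₀ * (P.d : ℝ) ^ 3 * C.e ^ 2 * ((P.L : ℝ) ^ (j.val + 1)) ^ 2 * δ j ^ 2 *
        (Ψ j ^ 2 * P.mesh (j.val + 1) ^ P.d * ((R.block j).card : ℝ)) / 4
      ≤ ∑ j : Fin K, C₀ * ((R.block j).card : ℝ) := by
    refine Finset.sum_le_sum fun j _ => ?_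
    have hcard : 0 ≤ ((R.block j).card : ℝ) := Nat.cast_nonneg _
    have := mul_le_mul_of_nonneg_right (hdens j) hcard
    calc 64 * γ₀ * (P.d : ℝ) ^ 3 * C.e ^ 2 * ((P.L : ℝ) ^ (j.val + 1)) ^ 2 * δ j ^ 2 *
          (Ψ j ^ 2 * P.mesh (j.val + 1) ^ P.d * ((R.block j).card : ℝ)) / 4
        = 16 * γ₀ * (P.d : ℝ) ^ 3 * C.e ^ 2 * ((P.L : ℝ) ^ (j.val + 1)) ^ 2 * δ j ^ 2 *
          (Ψ j ^ 2 * P.mesh (j.val + 1) ^ P.d) * ((R.block j).card : ℝ) := by ring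
      _ ≤ C₀ * ((R.block j).card : ℝ) := this
  linarith

/-- **(3.22) ⇒ (3.39) AT A REGULAR `Ã^ε ≠ 0`, PRINTED SHAPE**: under the exponent bookkeeping
`16γ₀d³e²(Lᵏδ_k)²Ψ_k²(Lᵏε)^d ≤ C₀` (the error density of the restricted Proposition 3.1 is `O((Lᵏε)^{κ₀}) ≤ O(1)` — any uniform
`C₀ ≥ 0`), `(3.22) ≤ Π_{j<K}ζ′_j · exp(E_{0,s}) · exp((½N log 2 + C₀)·Σ_{k=0}^{K}|Λ_k|)` — the printed (3.39) with its `O(1) =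
½N log 2 + C₀`, the `Σ_{k=1}^{K}O((Lᵏε)^{κ₀})|Λ_k|` of (3.35) absorbed as on p. 591; the zero-field case (`C₀ = 0`) is gen 6's
`B2Ineq335ZeroFieldConcrete.ineq339_zeroField`. [cite: Balaban1982Higgs2, (3.39) p.591, (3.35) p.591, Prop. 3.1 (3.26) p.589] -/
theorem ineq339_regular (hR : Nested R) (hK : K ≤ P.K) (hε : P.mesh K ≤ 1) (ha : 0 < a) (hL : 1 < P.L)
    (hmsq : 0 < msq) {δ : Fin K → ℝ} (hδ : ∀ j, 0 ≤ δ j)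
    (hreg : ∀ (j : Fin K), ∀ z ∈ pieceF R j, ∀ μ' ν : Fin P.d, |A ⟨z.shift ν, μ'⟩ - A ⟨z, μ'⟩| ≤ δ j)
    (hsmall : ∀ j : Fin K, 8 * (P.d : ℝ) ^ 4 * (P.L : ℝ) ^ P.d * C.e ^ 2 * P.mesh (j.val + 1) ^ 2 *
      ((P.L : ℝ) ^ (j.val + 1)) ^ 2 * δ j ^ 2 ≤ 1 / 2)
    {γ₀ : ℝ} (hγ0 : 0 ≤ γ₀) (hγB : γ₀ * (8 * P.d + 2 * msq + 4) ≤ a * (1 - ((P.L : ℝ) ^ 2)⁻¹))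
    (hγ16 : γ₀ ≤ 1 / 16) (Ψ : Fin K → ℝ) {C₀ : ℝ} (hC₀ : 0 ≤ C₀)
    (hdens : ∀ j : Fin K, 16 * γ₀ * (P.d : ℝ) ^ 3 * C.e ^ 2 * ((P.L : ℝ) ^ (j.val + 1)) ^ 2 * δ j ^ 2 *
      (Ψ j ^ 2 * P.mesh (j.val + 1) ^ P.d) ≤ C₀)
    {s : ℕ → ℝ} (hs : ∀ j, 0 < s j)
    {c : (j : ℕ) → ((i : ℕ) → Sites R O i → V N) → Sites R O (j + 1) → V N} (hc : ∀ j, Measurable (c j))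
    (hcdep : ∀ j i, j + 1 ≤ i → ∀ (x : (i : ℕ) → Sites R O i → V N) (y : Sites R O i → V N),
      c j (update x i y) = c j x)
    {r : ℕ → ℝ} (hr : ∀ j, 4 * (N : ℝ) * Real.log 2 ≤ a * r j)
    {b : ((i : ℕ) → Sites R O i → V N) → ℝ} (hb : ∀ x, 0 ≤ b x ∧ b x ≤ 1)
    (hrestr : ∀ x, b x ≠ 0 → ∀ (j : Fin K) (y : LSite R j), ‖resL R j (cfgOf R (x 0)) y‖ ≤ Ψ j)
    (w : (j : Fin K) → ι j → ℝ) (hw : ∀ j τ, 0 ≤ w j τ)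
    (Q : (j : Fin K) → ι j → Finset (Bnd P)) (hQ : ∀ j τ, Q j τ ⊆ bondSet R j)
    (Pex : (j : Fin K) → ι j → Finset (Sites R O (j + 1)))
    (χQ : (j : Fin K) → ι j → (KSite R → V N) → ℝ) (hχ : ∀ j τ u, χQ j τ u = 0 ∨ χQ j τ u = 1)
    (hlarge : ∀ j τ u, χQ j τ u = 1 → ∀ bb ∈ Q j τ, r j < bondTermA R C A u bb)
    (x : (i : ℕ) → Sites R O i → V N) :
    (rhs322 (fun i => (volume : Measure (Sites R O i → V N)))
        (fun u => ENNReal.ofReal (Z325 R C a A msq * Real.exp (-(form325 R C a A msq (cfgOf R u) / 2))))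
        (fun x => ENNReal.ofReal (b x))
        (gaussLevel (fun j _ => a * s j) c) (fun j τ => ENNReal.ofReal (w j τ))
        (fun j τ u => ENNReal.ofReal (χQ j τ u))
        (fun j τ => excLevel c j (largeFieldSite (Pex j τ) (s j) (r j))) x).toReal
      ≤ (∏ j : Fin K, ∑ τ : ι j, w j τ * Real.exp (-(γ₀ * r j * (Q j τ).card / 4))
            * Real.exp (-(a * r j / 8)) ^ (Pex j τ).card)
        * Real.exp (E0s P C msq)
        * Real.exp (((N : ℝ) * Real.log 2 / 2 + C₀) * ∑ k ∈ Finset.range (K + 1), vol R k) := by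
  have h := ineq339_regular_explicit R C A hR hK hε ha hL hmsq hδ hreg hsmall hγ0 hγB hγ16 Ψ hs hc hcdep hr hb hrestr
    w hw Q hQ Pex χQ hχ hlarge x
  have hE := sum_errTerm_div_four_le (R := R) (C := C) (γ₀ := γ₀) δ Ψ hC₀ hdens
  set Zp : ℝ := ∏ j : Fin K, ∑ τ : ι j, w j τ * Real.exp (-(γ₀ * r j * (Q j τ).card / 4))
    * Real.exp (-(a * r j / 8)) ^ (Pex j τ).card with hZp
  set Sv : ℝ := ∑ k ∈ Finset.range (K + 1), vol R k with hSv
  have hterm0 : ∀ j τ, 0 ≤ w j τ * Real.exp (-(γ₀ * r j * (Q j τ).card / 4))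
      * Real.exp (-(a * r j / 8)) ^ (Pex j τ).card := fun j τ => by
    have := hw j τ; positivity
  have hZp0 : 0 ≤ Zp := Finset.prod_nonneg fun j _ => Finset.sum_nonneg fun τ _ => hterm0 j τ
  have hfac : 0 ≤ Zp * Real.exp (E0s P C msq) := mul_nonneg hZp0 (Real.exp_pos _).le
  refine h.trans ?_
  rw [mul_assoc (Zp * Real.exp (E0s P C msq)), ← Real.exp_add]
  refine mul_le_mul_of_nonneg_left (Real.exp_le_exp.2 ?_) hfac
  rw [add_zero, add_mul]
  linarith

end Knit


end Literature.MathematicalPhysics.QuantumFieldTheory.Balaban1983to89.B2Ineq339RegularFieldConcrete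

end
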